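import Mathlib
import Summits.Schanuel.Schanuel.Theorems.RigidCoreMinimalCounterexampleInAclCorankGeTwoLogPart

/-!
# The exact hypothesis of arithmetic isolation of the log part: APERIODICITY of the hit pattern
# (crux stmt-Schanuel-0969 `RigidCore.MinimalCounterexampleInAcl`, line kernel-arithmetic-selection, lead c13)

`--supports stmt-Schanuel-0969`; companion of Theorems/…CorankGeTwoLogPart (p141402).  The definable-class selector
(`definableClassSelector`, Theorems/…DefinableClassSelector) needs exactly that the hit pattern of the log part has NO PERIOD; "no full
line in a log direction through `x`" (stub S7b, `stub_corankGeTwo_noFullLine`) is a convenient sufficient condition (`aperiodic_of_noFullLine`):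
a period `μ ≠ 0` makes EVERY hit line in direction `μ` full, in particular the one through `x`.  After wave 1 of lead c13 returned S7b
`stub-blocked` at corank ≥ 2 (obstruction note `Cruxes/MinimalCounterexampleInAcl/Lines/kernel_arithmetic_selection_S7b_obstruction.md`: the missing
input is a free coset-line sparsity statement in dimension ≥ 2), this file records the weakest form the lever needs, in the cast-free coordinate
language of …CorankGeTwoLogPart:

* `frameAperiodic_of_aperiodic` — cast-free aperiodicity over `Fin n` (periods supported on the log indices) gives aperiodicity of the frame
  pattern over `Fin r`;
* `logCoords_mem_expAcl_of_pattern_of_aperiodic` (registered `stub_corankGeTwo_logPartAperiodic`) — [cast-free pattern `∅`-definable in `ℂ_exp`]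
  ∧ [no non-zero period supported on the log indices] ⟹ every log coordinate `x_i` (`i < r`) is in `acl^{ℂ_exp}(∅)`.

References: [KirbyMacintyreOnshuus2012] J. Kirby, A. Macintyre, A. Onshuus, *The algebraic numbers definable in various exponential fields*,
J. Inst. Math. Jussieu 11 (2012) §2; status note `Cruxes/MinimalCounterexampleInAcl/Lines/kernel_arithmetic_selection.md` §Addendum c13.
-/

noncomputable section

set_option linter.dupNamespace false

open Complex Set FirstOrder

namespace Summit.Schanuel.Schanuel.Cruxes.MinimalCounterexampleInAcl.KernelArithmeticSelection

open Literature.ModelTheory.ExponentialFields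
open Summit.Schanuel.Schanuel.Theorems.AclSubsetLogFreeCore.Negative

variable {n r : ℕ}

/-! ## Aperiodicity in the cast-free form, and the selector under the exact hypothesis -/

/-- **Frame form of cast-free aperiodicity.**  If every `μ ∈ ℤⁿ` supported on the log indices that is a period of the cast-free hit pattern of the
log part (`κ` a hit ↔ `μ + κ` a hit, for all `κ` supported on the log indices) vanishes, then the frame pattern over `Fin r` is aperiodic in
the sense of `definableClassSelector`. [folklore] -/
theorem frameAperiodic_of_aperiodic (hr : r ≤ n) {x : Fin n → ℂ}
    (haper : ∀ μ : Fin n → ℤ, (∀ i : Fin n, r ≤ (i : ℕ) → μ i = 0) →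
      (∀ κ : Fin n → ℤ, (∀ i : Fin n, r ≤ (i : ℕ) → κ i = 0) →
        ((∃ x' ∈ locusMates x, ∀ i : Fin n, (i : ℕ) < r → x' i = x i + 2 * ↑Real.pi * I * (κ i : ℂ)) ↔
          ∃ x' ∈ locusMates x, ∀ i : Fin n, (i : ℕ) < r → x' i = x i + 2 * ↑Real.pi * I * ((μ + κ) i : ℂ))) → μ = 0) :
    ∀ μ : Fin r → ℤ,
      (∀ κ : Fin r → ℤ, (fun k => x (Fin.castLE hr k) + 2 * ↑Real.pi * I * (κ k : ℂ)) ∈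
          {v : Fin r → ℂ | ∃ x' ∈ locusMates x, ∀ k, v k = x' (Fin.castLE hr k)} ↔
        (fun k => x (Fin.castLE hr k) + 2 * ↑Real.pi * I * ((μ + κ : Fin r → ℤ) k : ℂ)) ∈
          {v : Fin r → ℂ | ∃ x' ∈ locusMates x, ∀ k, v k = x' (Fin.castLE hr k)}) → μ = 0 := by
  intro μ hper
  set ext0 : (Fin r → ℤ) → Fin n → ℤ := fun κ i => if h : (i : ℕ) < r then κ ⟨i, h⟩ else 0 with hext0
  have hsupp : ∀ κ : Fin r → ℤ, ∀ i : Fin n, r ≤ (i : ℕ) → ext0 κ i = 0 := fun κ i hi => by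
    have : ¬ (i : ℕ) < r := not_lt.2 hi
    simp [hext0, this]
  have hcast : ∀ (κ : Fin r → ℤ) (k : Fin r), ext0 κ (Fin.castLE hr k) = κ k := fun κ k => extendByZero_apply_castLE hr κ k
  -- the hit condition in the two forms
  have hiff : ∀ κ : Fin r → ℤ,
      ((fun k => x (Fin.castLE hr k) + 2 * ↑Real.pi * I * (κ k : ℂ)) ∈
          {v : Fin r → ℂ | ∃ x' ∈ locusMates x, ∀ k, v k = x' (Fin.castLE hr k)}) ↔
        ∃ x' ∈ locusMates x, ∀ i : Fin n, (i : ℕ) < r → x' i = x i + 2 * ↑Real.pi * I * (ext0 κ i : ℂ) := by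
    intro κ
    refine ⟨fun ⟨x', hx', hv⟩ => ⟨x', hx', fun i hi => ?_⟩, fun ⟨x', hx', hv⟩ => ⟨x', hx', fun k => ?_⟩⟩
    · have e : ext0 κ i = κ ⟨i, hi⟩ := by simp [hext0, hi]
      rw [e]; simpa using (hv ⟨i, hi⟩).symm
    · have h := hv (Fin.castLE hr k) (by simp)
      rw [hcast] at h; exact h.symm
  have hμ := haper (ext0 μ) (hsupp μ) fun κ hκ => by
    -- restrict `κ` to `Fin r`; it is the extension by zero of its restriction
    have eκ : ext0 (fun k => κ (Fin.castLE hr k)) = κ := by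
      funext i
      by_cases hi : (i : ℕ) < r
      · simp only [hext0, hi, dif_pos]; congr 1
      · simp only [hext0, hi, dif_neg, not_false_eq_true]; exact (hκ i (not_lt.1 hi)).symm
    have eμκ : ext0 (μ + fun k => κ (Fin.castLE hr k)) = ext0 μ + κ := by
      funext i
      by_cases hi : (i : ℕ) < r
      · have := congr_fun eκ i
        simp only [hext0, hi, dif_pos] at this
        simp only [hext0, hi, dif_pos, Pi.add_apply]; rw [this]
      · simp only [hext0, hi, dif_neg, not_false_eq_true, Pi.add_apply, zero_add]; exact (hκ i (not_lt.1 hi)).symm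
    have h1 := hiff (fun k => κ (Fin.castLE hr k))
    have h2 := hiff (μ + fun k => κ (Fin.castLE hr k))
    rw [eκ] at h1; rw [eμκ] at h2
    rw [← h1, ← h2]; exact hper _
  funext k
  have := congr_fun hμ (Fin.castLE hr k)
  rw [hcast] at this; simpa using this

/-- **LOG COORDINATES IN `acl(∅)` FROM A DEFINABLE HIT PATTERN WITHOUT PERIOD** — the exact hypothesis the definable-class selector needs
(weaker than "no full line": a period `μ ≠ 0` makes EVERY hit line in direction `μ` full, in particular the one through `x`).  For ℚ-linearly
independent `x` with `e^{x_i}` algebraic for `i < r`: [cast-free pattern `∅`-definable in `ℂ_exp`] ∧ [no non-zero `μ` supported on the log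
indices is a period of the pattern] ⟹ `x_i ∈ acl^{ℂ_exp}(∅)` for all `i < r` (`definableClassSelector` in the coordinate frame).
[cite: KirbyMacintyreOnshuus2012, §2] -/
theorem logCoords_mem_expAcl_of_pattern_of_aperiodic (hr : r ≤ n) {x : Fin n → ℂ} (hx : LinearIndependent ℚ x)
    (halg : ∀ i : Fin n, (i : ℕ) < r → IsAlgebraic ℚ (cexp (x i)))
    (hP : (∅ : Set ℂ).Definable Language.expRing
      {w : Fin n → ℂ | ∃ κ : Fin n → ℤ, (∀ i, w i = (κ i : ℂ)) ∧ (∀ i : Fin n, r ≤ (i : ℕ) → κ i = 0) ∧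
        ∃ x' ∈ locusMates x, ∀ i : Fin n, (i : ℕ) < r → x' i = x i + 2 * ↑Real.pi * I * (κ i : ℂ)})
    (haper : ∀ μ : Fin n → ℤ, (∀ i : Fin n, r ≤ (i : ℕ) → μ i = 0) →
      (∀ κ : Fin n → ℤ, (∀ i : Fin n, r ≤ (i : ℕ) → κ i = 0) →
        ((∃ x' ∈ locusMates x, ∀ i : Fin n, (i : ℕ) < r → x' i = x i + 2 * ↑Real.pi * I * (κ i : ℂ)) ↔
          ∃ x' ∈ locusMates x, ∀ i : Fin n, (i : ℕ) < r → x' i = x i + 2 * ↑Real.pi * I * ((μ + κ) i : ℂ))) → μ = 0) :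
    ∀ i : Fin n, (i : ℕ) < r → x i ∈ expAcl := by
  set M : Fin r → Fin n → ℤ := fun k i => if (i : ℕ) = (k : ℕ) then 1 else 0 with hM
  have hsum : ∀ (y : Fin n → ℂ) (k : Fin r), (∑ i, (M k i : ℂ) * y i) = y (Fin.castLE hr k) :=
    fun y k => coordFrameLT_sum hr y k
  have hVdef : (∅ : Set ℂ).Definable Language.expRing {v : Fin r → ℂ | ∃ x' ∈ locusMates x, ∀ k, v k = x' (Fin.castLE hr k)} := by
    rw [← valueTuples_coordFrameLT hr x]; exact valueTuples_definable x M
  have hVfin : ((fun v : Fin r → ℂ => cexp ∘ v) '' {v : Fin r → ℂ | ∃ x' ∈ locusMates x, ∀ k, v k = x' (Fin.castLE hr k)}).Finite := by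
    have halg' : ∀ k, IsAlgebraic ℚ (cexp (∑ i, (M k i : ℂ) * x i)) := fun k => by
      rw [hsum]; exact halg _ (by simp)
    rw [← valueTuples_coordFrameLT hr x]; exact cexp_image_valueTuples_finite x M halg'
  have huV : (fun k => x (Fin.castLE hr k)) ∈ {v : Fin r → ℂ | ∃ x' ∈ locusMates x, ∀ k, v k = x' (Fin.castLE hr k)} :=
    ⟨x, self_mem_locusMates x hx, fun _ => rfl⟩
  have key := definableClassSelector hVdef hVfin huV (framePattern_definable_of_pattern hr hP) (frameAperiodic_of_aperiodic hr haper)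
  intro i hi
  have h := key ⟨i, hi⟩
  simpa using h


/-! ## Registered form (`ledger workitem stub-add stmt-Schanuel-0969 --name stub_corankGeTwo_logPartAperiodic …`) -/

/-- Registered form of `logCoords_mem_expAcl_of_pattern_of_aperiodic` (stub `stub_corankGeTwo_logPartAperiodic` of crux stmt-Schanuel-0969, line
kernel-arithmetic-selection, lead c13): **log coordinates in `acl^{ℂ_exp}(∅)` from a definable hit pattern WITHOUT PERIOD** (every rank, any `r ≤ n`). -/
theorem stub_corankGeTwo_logPartAperiodic : ∀ (n r : ℕ), r ≤ n → ∀ (x : Fin n → ℂ), LinearIndependent ℚ x → (∀ i : Fin n, (i : ℕ) < r → IsAlgebraic ℚ (Complex.exp (x i))) → (∅ : Set ℂ).Definable Literature.ModelTheory.ExponentialFields.Language.expRing {w : Fin n → ℂ | ∃ κ : Fin n → ℤ, (∀ i, w i = (κ i : ℂ)) ∧ (∀ i : Fin n, r ≤ (i : ℕ) → κ i = 0) ∧ ∃ x' ∈ Summit.Schanuel.Schanuel.Cruxes.MinimalCounterexampleInAcl.KernelArithmeticSelection.locusMates x, ∀ i : Fin n, (i : ℕ) < r → x' i = x i + 2 *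 ↑Real.pi * Complex.I * (κ i : ℂ)} → (∀ μ : Fin n → ℤ, (∀ i : Fin n, r ≤ (i : ℕ) → μ i = 0) → (∀ κ : Fin n → ℤ, (∀ i : Fin n, r ≤ (i : ℕ) → κ i = 0) → ((∃ x' ∈ Summit.Schanuel.Schanuel.Cruxes.MinimalCounterexampleInAcl.KernelArithmeticSelection.locusMates x, ∀ i : Fin n, (i : ℕ) < r → x' i = x i + 2 * ↑Real.pi * Complex.I * (κ i : ℂ)) ↔ ∃ x' ∈ Summit.Schanuel.Schanuel.Cruxes.MinimalCounterexampleInAcl.KernelArithmeticSelection.locusMates x, ∀ i : Fin n, (i : ℕ) < r → x' i = x i + 2 * ↑Real.pi * Complex.I * ((μ + κ) i : ℂ))) → μ = 0) → ∀ i : Fin n, (i : ℕ) < r → x i ∈ Summit.Schanuel.Schanuel.Theorems.AclSubsetLogFreeCore.Negative.expAcl :=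
  fun _ _ hr _ hx halg hP haper => logCoords_mem_expAcl_of_pattern_of_aperiodic hr hx halg hP haper

end Summit.Schanuel.Schanuel.Cruxes.MinimalCounterexampleInAcl.KernelArithmeticSelection

end
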